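import Summits.HubbardSuperconductivity.HubbardLadder.Bounds.StiffnessCeilingCurrentMoments
import Literature.MathematicalPhysics.QuantumLattice.HubbardNNNHoppingFluxGaugeFunction
import HarnessLib

/-!
# The gauge-function (resistor-network) stiffness ceiling (pub-hubbard BOUNDS; bounds.tex Thm 4; proved)

HONEST FRAMING: ladder R1–R4 with certified numbers; no claim on H/H₀. Bounds for a MODEL CLASS
(the `t–t'` Hubbard torus `hubbardTorusTT' L 1 t' U` on `(ℤ/L)²`, every `t'`, `U`, filling
`n = 1 − δ`, `T = 0`), no materials claim.

This file machine-checks bounds.tex Theorem 4 (Paramekanti–Trivedi–Randeria 1998 §IV, the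
variational bound with a gauge function / resistor network, `D_s ≤ D_s* ≤ D°_s ≤ ⟨K⟩`) for the
`t–t'–U` torus at `T = 0`, in a SHARPENED form:

* `GaugeFunctionStiffnessCeilingTT'` (PROVED, `gaugeFunctionStiffnessCeilingTT'_holds`): for
  `L ≥ 3`, every `t'`, `U`, `δ`, every `θ₀ > 0` and every real `ρ_s` (ANY sign) with
  `ρ_s θ² ≤ E^{tt'}_L(θ) − E^{tt'}_L(0)` on `|θ| ≤ θ₀`, every unit zero-flux `(N_L, 0)`-sector ground
  state `ψ` and EVERY `φ : (ℤ/L)² → ℝ`,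
  `ρ_s L² ≤ Σ_{x,i,σ} (δ_{i,0} + φ(x+eᵢ) − φ(x))² Re h_{x,i,σ}(ψ)
          + t' Σ_{s,x,σ} (1 + φ(x+j_s) − φ(x))² Re h^d_{s,x,σ}(ψ)`,
  `h_{x,i,σ} = ⟨ψ, c†_{x+eᵢ,σ} c_{x,σ} ψ⟩`, `h^d_{s,x,σ} = ⟨ψ, c†_{x+j_s,σ} c_{x,σ} ψ⟩`. SHARPENING over the
  paper (`κ_b⁺`, `1 − cos u ≤ u²/2`): the exact bond weights `κ_b` of either sign enter, because the
  quadratic form is extracted from the Literature `1 − cos` bound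
  (`fluxEnergyTT'_sub_le_oneSubCos_trialGauge`) by the limit `θ → 0`, not by a convexity inequality;
  and no sign hypothesis on `ρ_s`. `φ = 0` is the f-sum ceiling `KinWeightStiffnessCeilingTT'`
  (`kinWeightStiffnessCeilingTT'_of_gauge`).
* `ColumnStiffnessCeilingTT'` (PROVED): potentials depending on `x₁` only — for every `g : ℤ/L → ℝ`
  with `Σ_c g(c) = L`, `ρ_s L² ≤ Σ_c g(c)² W_c(ψ)`, `W_c = Σ_{x : x₁ = c} w_x` the column weight of the
  crossing weights `w_x = Σ_σ Re h_{x,0,σ} + t' Σ_{s,σ} Re h^d_{s,x,σ}` (bonds from column `c` to `c + 1`).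
* `SeriesLawStiffnessCeilingTT'` (PROVED; PTR98 eqs. (1d-bd), (leg-bd), the resistor series law): if
  every `W_c` is positive then `ρ_s ≤ (Σ_c W_c⁻¹)⁻¹` (≤ the arithmetic mean `(K_x + t'K_d)/L²` = f-sum).
* `BottleneckStiffnessCeilingTT'` (PROVED): `ρ_s ≤ W_c` for EVERY column `c`, with no sign
  hypothesis at all — one weak column bounds the stiffness.

For a translation-invariant state all `W_c` coincide and the column bounds reduce to the f-sum
ceiling (PTR98 §IV: "the two bounds coincide for the non-disordered problem"); the content is for
inhomogeneous (e.g. symmetry-broken degenerate) sector ground states, and the typed inequality is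
what bounds.tex Thm 4 asserts for the general class on paper. `T > 0` (trial density matrix
`UρU†`, PTR98 §IV) is NOT in this file.

References: ParamekantiTrivediRanderia1998 §IV eqs. (trial)–(leg-bd); HazraVermaRanderia2019 (2)–(4).
-/

noncomputable section

namespace Summit.HubbardSuperconductivity.HubbardLadder.Bounds

open Finset Real Matrix
open Literature.MathematicalPhysics.QuantumLattice Literature.MathematicalPhysics.QuantumFieldTheory
  Literature.Probability.LatticeModels
open scoped ComplexConjugate ComplexOrder

/-! ### The `θ → 0` limit for a finite family of bonds -/

/-- Per bond: `2(1 − cos u) w ≤ u² w + (5/48) u⁴ |w|` for `|u| ≤ 1` (from `abs_one_sub_cos_sub_le`). -/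
theorem two_mul_one_sub_cos_mul_le {u w : ℝ} (hu : |u| ≤ 1) :
    2 * (1 - Real.cos u) * w ≤ u ^ 2 * w + 5 / 48 * u ^ 4 * |w| := by
  have hc := abs_one_sub_cos_sub_le (abs_nonneg u) hu
  rw [Real.cos_abs] at hc
  have hu4 : |u| ^ 4 = u ^ 4 := by rw [show (4 : ℕ) = 2 * 2 from rfl, pow_mul, pow_mul, sq_abs]
  rw [sq_abs, hu4] at hc
  have key : (2 * (1 - Real.cos u) - u ^ 2) * w ≤ 5 / 48 * u ^ 4 * |w| := by
    calc (2 * (1 - Real.cos u) - u ^ 2) * w ≤ |(2 * (1 - Real.cos u) - u ^ 2) * w| := le_abs_self _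
      _ = |2 * (1 - Real.cos u) - u ^ 2| * |w| := abs_mul _ _
      _ = 2 * |(1 - Real.cos u) - u ^ 2 / 2| * |w| := by
          rw [show 2 * (1 - Real.cos u) - u ^ 2 = 2 * ((1 - Real.cos u) - u ^ 2 / 2) by ring,
            abs_mul, abs_two]
      _ ≤ 2 * (5 / 96 * u ^ 4) * |w| :=
          mul_le_mul_of_nonneg_right (mul_le_mul_of_nonneg_left hc zero_le_two) (abs_nonneg w)
      _ = 5 / 48 * u ^ 4 * |w| := by ring
  linarith

/-- **The `θ → 0` extraction for a finite family of bonds.** If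
`ρ θ² ≤ Σ_i 2(1 − cos((θ/L) d_i)) w_i` for all `θ ∈ (0, θ₁]` (`L > 0`), then `ρ L² ≤ Σ_i d_i² w_i` —
no sign hypothesis on `ρ` or on the weights `w_i` (expand the cosine to fourth order and let
`θ → 0`; `false_of_forall_le_mul_sq`). -/
theorem mul_sq_le_sum_of_forall_oneSubCos {ι : Type*} [Fintype ι] {ρ θ₁ L : ℝ} (hL : 0 < L)
    (hθ₁ : 0 < θ₁) (w d : ι → ℝ)
    (h : ∀ θ : ℝ, 0 < θ → θ ≤ θ₁ →
      ρ * θ ^ 2 ≤ ∑ i, 2 * (1 - Real.cos (θ / L * d i)) * w i) :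
    ρ * L ^ 2 ≤ ∑ i, d i ^ 2 * w i := by
  by_contra hcon
  push Not at hcon
  have hε : 0 < ρ * L ^ 2 - ∑ i, d i ^ 2 * w i := sub_pos.2 hcon
  set D : ℝ := ∑ i, |d i| with hD
  have hD0 : 0 ≤ D := Finset.sum_nonneg fun i _ => abs_nonneg (d i)
  have hdi : ∀ i, |d i| ≤ D := fun i =>
    Finset.single_le_sum (f := fun i => |d i|) (fun i _ => abs_nonneg (d i)) (Finset.mem_univ i)
  set C : ℝ := ∑ i, 5 / 48 * d i ^ 4 * |w i| with hC
  have hC0 : 0 ≤ C := Finset.sum_nonneg fun i _ => by positivity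
  refine false_of_forall_le_mul_sq hε hC0 (lt_min (div_pos hθ₁ hL) (div_pos one_pos (by linarith)))
    (x₁ := min (θ₁ / L) (1 / (D + 1))) fun x hx0 hx1 => ?_
  have hxD : x ≤ 1 / (D + 1) := hx1.trans (min_le_right _ _)
  have hθ := h (L * x) (mul_pos hL hx0) (by rw [← le_div_iff₀' hL]; exact hx1.trans (min_le_left _ _))
  rw [mul_div_cancel_left₀ x hL.ne'] at hθ
  have hu : ∀ i, |x * d i| ≤ 1 := fun i => by
    rw [abs_mul, abs_of_pos hx0]
    calc x * |d i| ≤ 1 / (D + 1) * D :=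
          mul_le_mul hxD (hdi i) (abs_nonneg _) (by positivity)
      _ ≤ 1 := by rw [div_mul_eq_mul_div, one_mul, div_le_one (by linarith)]; linarith
  have hsum : ∑ i, 2 * (1 - Real.cos (x * d i)) * w i ≤
      x ^ 2 * (∑ i, d i ^ 2 * w i) + x ^ 4 * C := by
    rw [hC, Finset.mul_sum, Finset.mul_sum, ← Finset.sum_add_distrib]
    refine Finset.sum_le_sum fun i _ => ?_
    have := two_mul_one_sub_cos_mul_le (w := w i) (hu i)
    calc 2 * (1 - Real.cos (x * d i)) * w i
        ≤ (x * d i) ^ 2 * w i + 5 / 48 * (x * d i) ^ 4 * |w i| := this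
      _ = x ^ 2 * (d i ^ 2 * w i) + x ^ 4 * (5 / 48 * d i ^ 4 * |w i|) := by ring
  have hx2 : 0 < x ^ 2 := by positivity
  have key : (ρ * L ^ 2 - ∑ i, d i ^ 2 * w i) * x ^ 2 ≤ C * x ^ 2 * x ^ 2 := by nlinarith
  exact le_of_mul_le_mul_right (by linarith) hx2

/-! ### Theorem 4, `T = 0`: the gauge-function stiffness ceiling -/

/-- **The gauge-function (resistor-network) stiffness ceiling for the `t–t'` class, `T = 0`**
(bounds.tex Thm 4, SHARPENED: exact bond weights of either sign, `ρ_s` of either sign; PTR98 §IV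
eqs. (heat), (var-bd) `D_s ≤ D_s* = min_φ`): for `L ≥ 3`, every `t'`, `U`, `δ`, `θ₀ > 0`, every real
`ρ_s` with `ρ_s θ² ≤ E^{tt'}_L(θ) − E^{tt'}_L(0)` for `|θ| ≤ θ₀`, every unit zero-flux
`(N_L, 0)`-sector ground state `ψ` of `hubbardTorusTT' L 1 t' U` and EVERY `φ : (ℤ/L)² → ℝ`:
`ρ_s L² ≤ Σ_{x,i,σ} (δ_{i,0} + φ(x+eᵢ) − φ(x))² Re h_{x,i,σ}(ψ) + t' Σ_{s,x,σ} (1 + φ(x+j_s) − φ(x))²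
Re h^d_{s,x,σ}(ψ)`. PROVED (`gaugeFunctionStiffnessCeilingTT'_holds`). -/
@[conjecture] def GaugeFunctionStiffnessCeilingTT' : Prop :=
  ∀ (L : ℕ) [NeZero L], 3 ≤ L → ∀ (t' U δ ρs θ₀ : ℝ), 0 < θ₀ →
    (∀ θ : ℝ, |θ| ≤ θ₀ → ρs * θ ^ 2 ≤ fluxEnergyTT' L t' U δ θ - fluxEnergyTT' L t' U δ 0) →
    ∀ ψ : Fock (Orb (FermionTorus 2 L)),
      IsGroundStateInSector (hubbardTorusTT' L 1 t' U) (2 * ⌊(1 - δ) * (L : ℝ) ^ 2 / 2⌋₊) 0 ψ →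
      star ψ ⬝ᵥ ψ = 1 → ∀ φ : Site 2 L → ℝ,
      ρs * (L : ℝ) ^ 2 ≤
        (∑ x : Site 2 L, ∑ i : Fin 2, ∑ σ : Fin 2,
            ((![1, 0] : Fin 2 → ℝ) i + φ (x.shift i) - φ x) ^ 2 *
              (star ψ ⬝ᵥ ((creation (orb (FermionTorus.ofTorusSite (Site.shift x i)) σ) *
                annihilation (orb (FermionTorus.ofTorusSite x) σ)) *ᵥ ψ)).re) +
          t' * ∑ s : Fin 2, ∑ x : Site 2 L, ∑ σ : Fin 2,
            (1 + φ (x + torusDiagJump L s) - φ x) ^ 2 *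
              (star ψ ⬝ᵥ ((creation (orb (FermionTorus.ofTorusSite (x + torusDiagJump L s)) σ) *
                annihilation (orb (FermionTorus.ofTorusSite x) σ)) *ᵥ ψ)).re

/-- PROOF of `GaugeFunctionStiffnessCeilingTT'`: the Literature `1 − cos` bound
`fluxEnergyTT'_sub_le_oneSubCos_trialGauge` (PTR trial state at `±θ`) for `0 < θ ≤ θ₀`, then
`mul_sq_le_sum_of_forall_oneSubCos` over the disjoint union of the nearest-neighbour and the
diagonal bond families. -/
theorem gaugeFunctionStiffnessCeilingTT'_holds : GaugeFunctionStiffnessCeilingTT' := by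
  intro L _ hL t' U δ ρs θ₀ hθ₀ hstiff ψ hgs h1 φ
  have hL0 : (0 : ℝ) < L := by exact_mod_cast (show 0 < L by omega)
  let w : (Site 2 L × Fin 2 × Fin 2) ⊕ (Fin 2 × Site 2 L × Fin 2) → ℝ :=
    Sum.elim
      (fun p => (star ψ ⬝ᵥ ((creation (orb (FermionTorus.ofTorusSite (Site.shift p.1 p.2.1)) p.2.2) *
        annihilation (orb (FermionTorus.ofTorusSite p.1) p.2.2)) *ᵥ ψ)).re)
      (fun q => t' * (star ψ ⬝ᵥ ((creation (orb (FermionTorus.ofTorusSite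
          (q.2.1 + torusDiagJump L q.1)) q.2.2) *
        annihilation (orb (FermionTorus.ofTorusSite q.2.1) q.2.2)) *ᵥ ψ)).re)
  let d : (Site 2 L × Fin 2 × Fin 2) ⊕ (Fin 2 × Site 2 L × Fin 2) → ℝ :=
    Sum.elim (fun p => (![1, 0] : Fin 2 → ℝ) p.2.1 + φ (p.1.shift p.2.1) - φ p.1)
      (fun q => 1 + φ (q.2.1 + torusDiagJump L q.1) - φ q.2.1)
  have hrhs : ∀ θ : ℝ,
      (∑ x : Site 2 L, ∑ i : Fin 2, ∑ σ : Fin 2,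
          2 * (1 - Real.cos (θ / L * ((![1, 0] : Fin 2 → ℝ) i + φ (x.shift i) - φ x))) *
            (star ψ ⬝ᵥ ((creation (orb (FermionTorus.ofTorusSite (Site.shift x i)) σ) *
              annihilation (orb (FermionTorus.ofTorusSite x) σ)) *ᵥ ψ)).re) +
        t' * ∑ s : Fin 2, ∑ x : Site 2 L, ∑ σ : Fin 2,
          2 * (1 - Real.cos (θ / L * (1 + φ (x + torusDiagJump L s) - φ x))) *
            (star ψ ⬝ᵥ ((creation (orb (FermionTorus.ofTorusSite (x + torusDiagJump L s)) σ) *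
              annihilation (orb (FermionTorus.ofTorusSite x) σ)) *ᵥ ψ)).re =
        ∑ b, 2 * (1 - Real.cos (θ / L * d b)) * w b := by
    intro θ
    simp only [w, d, Fintype.sum_sum_type, Fintype.sum_prod_type, Sum.elim_inl, Sum.elim_inr,
      Finset.mul_sum]
    congr 1
    refine Finset.sum_congr rfl fun s _ => Finset.sum_congr rfl fun x _ =>
      Finset.sum_congr rfl fun σ _ => ?_
    ring
  have hconc :
      (∑ x : Site 2 L, ∑ i : Fin 2, ∑ σ : Fin 2,
          ((![1, 0] : Fin 2 → ℝ) i + φ (x.shift i) - φ x) ^ 2 *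
            (star ψ ⬝ᵥ ((creation (orb (FermionTorus.ofTorusSite (Site.shift x i)) σ) *
              annihilation (orb (FermionTorus.ofTorusSite x) σ)) *ᵥ ψ)).re) +
        t' * ∑ s : Fin 2, ∑ x : Site 2 L, ∑ σ : Fin 2,
          (1 + φ (x + torusDiagJump L s) - φ x) ^ 2 *
            (star ψ ⬝ᵥ ((creation (orb (FermionTorus.ofTorusSite (x + torusDiagJump L s)) σ) *
              annihilation (orb (FermionTorus.ofTorusSite x) σ)) *ᵥ ψ)).re =
        ∑ b, d b ^ 2 * w b := by
    simp only [w, d, Fintype.sum_sum_type, Fintype.sum_prod_type, Sum.elim_inl, Sum.elim_inr,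
      Finset.mul_sum]
    congr 1
    refine Finset.sum_congr rfl fun s _ => Finset.sum_congr rfl fun x _ =>
      Finset.sum_congr rfl fun σ _ => ?_
    ring
  rw [hconc]
  refine mul_sq_le_sum_of_forall_oneSubCos hL0 hθ₀ w d fun θ hθ hθ1 => ?_
  rw [← hrhs θ]
  exact (hstiff θ (by rwa [abs_of_pos hθ])).trans
    (fluxEnergyTT'_sub_le_oneSubCos_trialGauge hL t' U δ θ φ hgs h1)

/-- `φ = 0`: the gauge-function ceiling contains the f-sum ceiling `KinWeightStiffnessCeilingTT'`
(PTR98: `D_s* ≤ D°_s ≤ ⟨K⟩`, the uniform trial state). -/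
theorem kinWeightStiffnessCeilingTT'_of_gauge (h : GaugeFunctionStiffnessCeilingTT') :
    KinWeightStiffnessCeilingTT' := by
  intro L _ hL t' U δ ρs θ₀ hθ₀ hstiff ψ hgs h1
  have key := h L hL t' U δ ρs θ₀ hθ₀ hstiff ψ hgs h1 (fun _ => 0)
  simp only [add_zero, sub_zero, one_pow, one_mul, Fin.sum_univ_two, Matrix.cons_val_zero,
    Matrix.cons_val_one, Matrix.cons_val_fin_one, ne_eq, OfNat.ofNat_ne_zero, not_false_eq_true,
    zero_pow, zero_mul] at key
  simpa only [Fin.sum_univ_two] using key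

/-! ### Column potentials: the series law and the bottleneck bound -/

section Columns

variable {L : ℕ} [NeZero L]

/-- The **crossing weight** of the site `x`: the kinetic weights of the three bonds from column `x₁`
to column `x₁ + 1` that start at `x` (`x → x + e₁` and the two diagonals `x → x + j_s`, the latter
weighted by `t'`): `w_x(ψ) = Σ_σ Re h_{x,0,σ}(ψ) + t' Σ_{s,σ} Re h^d_{s,x,σ}(ψ)`. -/
def xCrossWeightTT' (t' : ℝ) (ψ : Fock (Orb (FermionTorus 2 L))) (x : Site 2 L) : ℝ :=
  (∑ σ : Fin 2, (star ψ ⬝ᵥ ((creation (orb (FermionTorus.ofTorusSite (Site.shift x 0)) σ) *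
      annihilation (orb (FermionTorus.ofTorusSite x) σ)) *ᵥ ψ)).re) +
    t' * ∑ s : Fin 2, ∑ σ : Fin 2,
      (star ψ ⬝ᵥ ((creation (orb (FermionTorus.ofTorusSite (x + torusDiagJump L s)) σ) *
        annihilation (orb (FermionTorus.ofTorusSite x) σ)) *ᵥ ψ)).re

/-- The **column weight** `W_c(ψ) = Σ_y w_{(c,y)}(ψ)`: the total kinetic weight across the cut
between the columns `x₁ = c` and `x₁ = c + 1` (the conductance of that cut in the PTR network). -/
def columnWeightTT' (t' : ℝ) (ψ : Fock (Orb (FermionTorus 2 L))) (c : ZMod L) : ℝ :=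
  ∑ y : ZMod L, xCrossWeightTT' t' ψ ![c, y]

/-- Column decomposition of a site sum: `Σ_x F(x) = Σ_c Σ_y F(c, y)`. -/
theorem sum_site_eq_sum_columns {M : Type*} [AddCommMonoid M] (F : Site 2 L → M) :
    ∑ x : Site 2 L, F x = ∑ c : ZMod L, ∑ y : ZMod L, F ![c, y] := by
  have h1 : ∑ x : Site 2 L, F x = ∑ x : Site 2 L, ∑ c : ZMod L, (if x 0 = c then F x else 0) := by
    refine Finset.sum_congr rfl fun x _ => ?_
    rw [Finset.sum_ite_eq, if_pos (Finset.mem_univ _)]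
  rw [h1, Finset.sum_comm]
  exact Finset.sum_congr rfl fun c _ => sum_site_ite_apply_zero_eq F c

/-- **A potential with prescribed bond drops around the cycle.** On `ℤ/L` (`L ≥ 2`), for every
`g : ℤ/L → ℝ` with `Σ_c g(c) = L` there is `f : ℤ/L → ℝ` with `1 + f(c+1) − f(c) = g(c)` for all `c`
(the winding `+1` per bond accounts for the total `L`). -/
theorem exists_potential_of_sum_eq (hL : 2 ≤ L) (g : ZMod L → ℝ) (hg : ∑ c : ZMod L, g c = L) :
    ∃ f : ZMod L → ℝ, ∀ c : ZMod L, 1 + f (c + 1) - f c = g c := by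
  have hsum : ∑ j ∈ Finset.range L, g (j : ZMod L) = ∑ c : ZMod L, g c := by
    obtain ⟨n, rfl⟩ : ∃ n, L = n + 1 := ⟨L - 1, (Nat.succ_pred_eq_of_pos (NeZero.pos L)).symm⟩
    rw [← Fin.sum_univ_eq_sum_range (fun j => g (j : ZMod (n + 1))) (n + 1)]
    exact Finset.sum_congr rfl fun c _ => congrArg g (ZMod.natCast_zmod_val (n := n + 1) c)
  refine ⟨fun c => (∑ j ∈ Finset.range c.val, g (j : ZMod L)) - c.val, fun c => ?_⟩
  by_cases hc : c = -1
  · have hv : c.val + 1 = L := (zmod_eq_neg_one_iff_val c).1 hc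
    have hc0 : c + 1 = 0 := by rw [hc, neg_add_cancel]
    have hsplit : ∑ j ∈ Finset.range L, g (j : ZMod L) =
        (∑ j ∈ Finset.range c.val, g (j : ZMod L)) + g c := by
      rw [show Finset.range L = Finset.range (c.val + 1) by rw [hv], Finset.sum_range_succ,
        ZMod.natCast_zmod_val c]
    simp only [hc0, ZMod.val_zero, Finset.range_zero, Finset.sum_empty, Nat.cast_zero, sub_zero]
    have hvR : (c.val : ℝ) = L - 1 := by
      have : ((c.val + 1 : ℕ) : ℝ) = L := by exact_mod_cast hv
      push_cast at this; linarith
    rw [hvR]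
    linarith [hsum, hsplit, hg]
  · have hv : (c + 1).val = c.val + 1 := zmod_val_add_one_of_ne_neg_one hL hc
    simp only [hv, Finset.sum_range_succ, ZMod.natCast_zmod_val, Nat.cast_add, Nat.cast_one]
    ring

omit [NeZero L] in
/-- Both diagonal jumps advance the column index by one: `(x + j_s)₁ = x₁ + 1`. -/
theorem add_torusDiagJump_apply_zero (x : Site 2 L) (s : Fin 2) :
    (x + torusDiagJump L s) 0 = x 0 + 1 := by
  simp [torusDiagJump]

/-- Weighted site sums of the crossing weights, split into the `e₁`-bond and the diagonal parts. -/
theorem sum_mul_xCrossWeightTT' (t' : ℝ) (ψ : Fock (Orb (FermionTorus 2 L))) (a : Site 2 L → ℝ) :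
    ∑ x : Site 2 L, a x * xCrossWeightTT' t' ψ x =
      (∑ x : Site 2 L, ∑ σ : Fin 2, a x *
          (star ψ ⬝ᵥ ((creation (orb (FermionTorus.ofTorusSite (Site.shift x 0)) σ) *
            annihilation (orb (FermionTorus.ofTorusSite x) σ)) *ᵥ ψ)).re) +
        t' * ∑ s : Fin 2, ∑ x : Site 2 L, ∑ σ : Fin 2, a x *
          (star ψ ⬝ᵥ ((creation (orb (FermionTorus.ofTorusSite (x + torusDiagJump L s)) σ) *
            annihilation (orb (FermionTorus.ofTorusSite x) σ)) *ᵥ ψ)).re := by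
  simp only [xCrossWeightTT', mul_add, Finset.sum_add_distrib, Finset.mul_sum]
  congr 1
  rw [Finset.sum_comm]
  refine Finset.sum_congr rfl fun s _ => Finset.sum_congr rfl fun x _ =>
    Finset.sum_congr rfl fun σ _ => ?_
  ring

/-- Column sums: a weight depending on `x₁` only sees the column weights `W_c`. -/
theorem sum_columns_mul_xCrossWeightTT' (t' : ℝ) (ψ : Fock (Orb (FermionTorus 2 L)))
    (G : ZMod L → ℝ) :
    ∑ x : Site 2 L, G (x 0) * xCrossWeightTT' t' ψ x = ∑ c : ZMod L, G c * columnWeightTT' t' ψ c := by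
  rw [sum_site_eq_sum_columns]
  refine Finset.sum_congr rfl fun c _ => ?_
  rw [columnWeightTT', Finset.mul_sum]
  refine Finset.sum_congr rfl fun y _ => ?_
  simp only [Matrix.cons_val_zero]

end Columns

/-- **Column form of the gauge-function ceiling** (PROVED): for `L ≥ 3` and data as in
`GaugeFunctionStiffnessCeilingTT'`, every `g : ℤ/L → ℝ` with `Σ_c g(c) = L` (the potential drops
across the `L` column cuts, total drop `L`) gives `ρ_s L² ≤ Σ_c g(c)² W_c(ψ)`
(`W_c = columnWeightTT'`; potentials `φ(x) = f(x₁)`, so the `e₂`-bonds carry no phase). -/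
@[conjecture] def ColumnStiffnessCeilingTT' : Prop :=
  ∀ (L : ℕ) [NeZero L], 3 ≤ L → ∀ (t' U δ ρs θ₀ : ℝ), 0 < θ₀ →
    (∀ θ : ℝ, |θ| ≤ θ₀ → ρs * θ ^ 2 ≤ fluxEnergyTT' L t' U δ θ - fluxEnergyTT' L t' U δ 0) →
    ∀ ψ : Fock (Orb (FermionTorus 2 L)),
      IsGroundStateInSector (hubbardTorusTT' L 1 t' U) (2 * ⌊(1 - δ) * (L : ℝ) ^ 2 / 2⌋₊) 0 ψ →
      star ψ ⬝ᵥ ψ = 1 → ∀ g : ZMod L → ℝ, ∑ c : ZMod L, g c = L →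
      ρs * (L : ℝ) ^ 2 ≤ ∑ c : ZMod L, g c ^ 2 * columnWeightTT' t' ψ c

/-- PROOF of `ColumnStiffnessCeilingTT'`: `GaugeFunctionStiffnessCeilingTT'` with `φ(x) = f(x₁)`,
`f` from `exists_potential_of_sum_eq`. -/
theorem columnStiffnessCeilingTT'_holds : ColumnStiffnessCeilingTT' := by
  intro L _ hL t' U δ ρs θ₀ hθ₀ hstiff ψ hgs h1 g hg
  obtain ⟨f, hf⟩ := exists_potential_of_sum_eq (by omega) g hg
  have key := gaugeFunctionStiffnessCeilingTT'_holds L hL t' U δ ρs θ₀ hθ₀ hstiff ψ hgs h1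
    (fun x => f (x 0))
  rw [← show (∑ x : Site 2 L, g (x 0) ^ 2 * xCrossWeightTT' t' ψ x) =
      ∑ c : ZMod L, g c ^ 2 * columnWeightTT' t' ψ c from
    sum_columns_mul_xCrossWeightTT' t' ψ (fun c => g c ^ 2)]
  refine key.trans_eq ?_
  rw [sum_mul_xCrossWeightTT']
  congr 1
  · refine Finset.sum_congr rfl fun x _ => ?_
    simp only [Fin.sum_univ_two, Matrix.cons_val_zero, Matrix.cons_val_one, Matrix.cons_val_fin_one,
      shift_zero_apply_zero, shift_one_apply_zero, hf, zero_add, sub_self, ne_eq, OfNat.ofNat_ne_zero,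
      not_false_eq_true, zero_pow, zero_mul, add_zero]
  · congr 1
    refine Finset.sum_congr rfl fun s _ => Finset.sum_congr rfl fun x _ =>
      Finset.sum_congr rfl fun σ _ => ?_
    rw [add_torusDiagJump_apply_zero, hf]

/-- **The series law (harmonic-mean) stiffness ceiling** (PROVED; PTR98 §IV eqs. (1d-bd), (leg-bd):
`D_s ≤ D°_s`, resistors in series along `e₁`): for `L ≥ 3` and data as in
`GaugeFunctionStiffnessCeilingTT'`, if every column weight `W_c(ψ)` (`columnWeightTT'`) is positive,
then `ρ_s ≤ (Σ_c W_c(ψ)⁻¹)⁻¹` — at most the harmonic mean of the column weights divided by `L`, hence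
at most their arithmetic mean `(K_x + t' K_d)(ψ)/L²` (the f-sum ceiling), with equality iff all `W_c`
agree. -/
@[conjecture] def SeriesLawStiffnessCeilingTT' : Prop :=
  ∀ (L : ℕ) [NeZero L], 3 ≤ L → ∀ (t' U δ ρs θ₀ : ℝ), 0 < θ₀ →
    (∀ θ : ℝ, |θ| ≤ θ₀ → ρs * θ ^ 2 ≤ fluxEnergyTT' L t' U δ θ - fluxEnergyTT' L t' U δ 0) →
    ∀ ψ : Fock (Orb (FermionTorus 2 L)),
      IsGroundStateInSector (hubbardTorusTT' L 1 t' U) (2 * ⌊(1 - δ) * (L : ℝ) ^ 2 / 2⌋₊) 0 ψ →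
      star ψ ⬝ᵥ ψ = 1 → (∀ c : ZMod L, 0 < columnWeightTT' t' ψ c) →
      ρs ≤ (∑ c : ZMod L, (columnWeightTT' t' ψ c)⁻¹)⁻¹

/-- PROOF of `SeriesLawStiffnessCeilingTT'`: `ColumnStiffnessCeilingTT'` with the Kirchhoff drops
`g(c) = λ / W_c`, `λ = L / Σ_c W_c⁻¹`. -/
theorem seriesLawStiffnessCeilingTT'_holds : SeriesLawStiffnessCeilingTT' := by
  intro L _ hL t' U δ ρs θ₀ hθ₀ hstiff ψ hgs h1 hW
  set W : ZMod L → ℝ := columnWeightTT' t' ψ with hWdef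
  set S : ℝ := ∑ c : ZMod L, (W c)⁻¹ with hS
  have hL0 : (0 : ℝ) < L := by exact_mod_cast (show 0 < L by omega)
  have hS0 : 0 < S := Finset.sum_pos (fun c _ => inv_pos.2 (hW c)) ⟨0, Finset.mem_univ _⟩
  set lam : ℝ := L / S with hlam
  have hg : ∑ c : ZMod L, lam / W c = L := by
    simp only [div_eq_mul_inv, ← Finset.mul_sum]
    rw [← hS, hlam, div_mul_cancel₀ _ hS0.ne']
  have key := columnStiffnessCeilingTT'_holds L hL t' U δ ρs θ₀ hθ₀ hstiff ψ hgs h1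
    (fun c => lam / W c) hg
  have hval : ∑ c : ZMod L, (lam / W c) ^ 2 * columnWeightTT' t' ψ c = lam * L := by
    calc ∑ c : ZMod L, (lam / W c) ^ 2 * columnWeightTT' t' ψ c
        = ∑ c : ZMod L, lam * (lam / W c) := by
          refine Finset.sum_congr rfl fun c _ => ?_
          rw [← hWdef]
          have hc : W c ≠ 0 := (hW c).ne'
          field_simp
      _ = lam * L := by rw [← Finset.mul_sum, hg]
  rw [hval, hlam] at key
  -- `ρ L² ≤ (L/S) L` ⇒ `ρ ≤ S⁻¹`
  have h2 : ρs * (L : ℝ) ^ 2 ≤ S⁻¹ * (L : ℝ) ^ 2 := by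
    calc ρs * (L : ℝ) ^ 2 ≤ L / S * L := key
      _ = S⁻¹ * (L : ℝ) ^ 2 := by rw [div_eq_mul_inv]; ring
  exact le_of_mul_le_mul_right h2 (by positivity)

/-- **The bottleneck stiffness ceiling** (PROVED): for `L ≥ 3` and data as in
`GaugeFunctionStiffnessCeilingTT'`, EVERY column bounds the stiffness, `ρ_s ≤ W_c(ψ)`
(`columnWeightTT'`), with no sign hypothesis on `ρ_s` or on the weights (put the whole potential
drop `L` across the cut `c`). One column of vanishing kinetic weight forces `ρ_s ≤ 0`. -/
@[conjecture] def BottleneckStiffnessCeilingTT' : Prop :=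
  ∀ (L : ℕ) [NeZero L], 3 ≤ L → ∀ (t' U δ ρs θ₀ : ℝ), 0 < θ₀ →
    (∀ θ : ℝ, |θ| ≤ θ₀ → ρs * θ ^ 2 ≤ fluxEnergyTT' L t' U δ θ - fluxEnergyTT' L t' U δ 0) →
    ∀ ψ : Fock (Orb (FermionTorus 2 L)),
      IsGroundStateInSector (hubbardTorusTT' L 1 t' U) (2 * ⌊(1 - δ) * (L : ℝ) ^ 2 / 2⌋₊) 0 ψ →
      star ψ ⬝ᵥ ψ = 1 → ∀ c : ZMod L, ρs ≤ columnWeightTT' t' ψ c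

/-- PROOF of `BottleneckStiffnessCeilingTT'`: `ColumnStiffnessCeilingTT'` with `g = L · [· = c]`. -/
theorem bottleneckStiffnessCeilingTT'_holds : BottleneckStiffnessCeilingTT' := by
  intro L _ hL t' U δ ρs θ₀ hθ₀ hstiff ψ hgs h1 c
  have hL0 : (0 : ℝ) < L := by exact_mod_cast (show 0 < L by omega)
  have hg : ∑ c' : ZMod L, (if c' = c then (L : ℝ) else 0) = L := by
    rw [Finset.sum_ite_eq', if_pos (Finset.mem_univ _)]
  have key := columnStiffnessCeilingTT'_holds L hL t' U δ ρs θ₀ hθ₀ hstiff ψ hgs h1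
    (fun c' => if c' = c then (L : ℝ) else 0) hg
  have hval : ∑ a : ZMod L, (if a = c then (L : ℝ) else 0) ^ 2 * columnWeightTT' t' ψ a =
      (L : ℝ) ^ 2 * columnWeightTT' t' ψ c := by
    simp only [ite_pow, ne_eq, OfNat.ofNat_ne_zero, not_false_eq_true, zero_pow, ite_mul, zero_mul,
      Finset.sum_ite_eq', Finset.mem_univ, if_true]
  exact le_of_mul_le_mul_right ((key.trans_eq hval).trans_eq (mul_comm _ _)) (by positivity)

end Summit.HubbardSuperconductivity.HubbardLadder.Bounds
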